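import Mathlib.AlgebraicGeometry.Modules.Tilde
import HarnessLib

/-!
# Finite presentation of `𝒪_X`-modules is local: restriction to opens, gluing from an open cover

Mathlib (pin v4.32) defines `SheafOfModules.IsFinitePresentation M` (The Stacks Project, Tag 01BN:
locally on a cover the cokernel of a morphism of finite free modules — through a `QuasicoherentData`
all of whose presentations are finite) and proves the basic permanence properties for
QUASI-COHERENCE only: `SheafOfModules.isQuasicoherent_pushforward(_of_isLeftAdjoint)`,
`isQuasicoherent_over`, `IsQuasicoherent.of_coversTop`, `Scheme.Modules.isQuasicoherent_restrictFunctor`,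
`Scheme.Modules.exists_isOpenCover_presentation`. This file records the finite-presentation analogues
with the same proofs — Mathlib's constructions `QuasicoherentData.pushforward`, `QuasicoherentData.bind`,
`QuasicoherentData.shrink`, `Presentation.map`, `Presentation.ofIsIso` keep the index types of generators
and relations, so finiteness is preserved:

* abstract sites: `isFinitePresentation_pushforward`, `isFinitePresentation_pushforward_of_isLeftAdjoint`,
  `isFinitePresentation_over` (`M.over X` is finitely presented if `M` is),
  `isFinitePresentation_of_coversTop` (finite presentation glues along a cover of the terminal object);
* schemes: `isFinitePresentation_restrict` — **`M|_X` is finitely presented for an open immersion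
  `X → Y` if `M` is**; `presentationRestrict_isFinite`, `presentationRestrictOfOver(_isFinite)`;
  `exists_isOpenCover_finitePresentation` — **a finitely presented `M` has finite global presentations
  `𝒪^m → 𝒪^n → M|_U → 0` on the members of an affine open cover**; conversely
  `isFinitePresentation_of_isOpenCover` / `isFinitePresentation_of_presentations` — **finite
  presentation may be checked on an open cover**; `isFinitePresentation_of_presentation` (a finite global
  presentation suffices), `isFinitePresentation_over_of_restrict`, `isFinitePresentation_overEquiv_inverse`,
  `isFinitePresentation_of_iso`, `isFinitePresentation_restrict_opensRange`,
  `isFinitePresentation_of_openCover` (`Scheme.OpenCover` form).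

Everything is proved; no named facts. Written for the boundedness bricks of
`Literature/AlgebraicGeometry/ModuliOfSheaves/LangerBoundedness` (coherent sheaves on `Z_T` glued from
pieces), usable by any file quantifying over `SheafOfModules.IsFinitePresentation` on schemes.

## References

* The Stacks Project, Tag 01BN (Sheaves of Modules, Section 17.11 "Modules of finite presentation":
  the definition is local on `X`; restriction to an open). [StacksProject]
-/

noncomputable section

open CategoryTheory CategoryTheory.Limits AlgebraicGeometry TopologicalSpace Opposite

universe u v₁ v₂ u₁ u₂

namespace Literature.AlgebraicGeometry.Modules

/-! ### Abstract sites -/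

section Abstract

variable {C : Type u₁} [Category.{v₁} C] {J : GrothendieckTopology C} {R : Sheaf J RingCat.{u}}
  [∀ (X : C), (J.over X).WEqualsLocallyBijective AddCommGrpCat.{u}]
  {D : Type u₂} [Category.{v₂} D] {K : GrothendieckTopology D}
  {S : Sheaf K RingCat.{u}} [∀ (X : D), (K.over X).WEqualsLocallyBijective AddCommGrpCat.{u}]
  [∀ (X : C), HasSheafify (J.over X) AddCommGrpCat.{u}]
  [∀ (X : D), HasSheafify (K.over X) AddCommGrpCat.{u}]
  (G : D ⥤ C) [G.IsContinuous K J] [G.IsCocontinuous K J]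
  (φ : S ⟶ (G.sheafPushforwardContinuous RingCat.{u} K J).obj R)

/-- The pushforward of a FINITE-presentation quasi-coherent data along a continuous and cocontinuous
functor is again a finite presentation (Mathlib's `QuasicoherentData.pushforward` maps each
presentation by `Presentation.map`, which keeps the index types). [folklore] -/
theorem quasicoherentData_pushforward_isFinitePresentation
    (η : (SheafOfModules.pushforward φ).obj (SheafOfModules.unit R) ≅ SheafOfModules.unit S)
    [∀ (X : D), (Over.post G).IsContinuous (K.over X) (J.over _)]
    (h : ∀ (X : D) (Y : C) (f : G.obj X ⟶ Y),
      PreservesColimitsOfSize.{u, u} <|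
      SheafOfModules.pushforward.{u} (R := (R.over Y)) (F := Over.post (X := X) G ⋙ Over.map f)
        (((Over.forget X).sheafPushforwardContinuous RingCat.{u} (K.over X) K).map φ))
    {M : SheafOfModules.{u} R} (P : M.QuasicoherentData) [P.IsFinitePresentation] :
    (P.pushforward G φ η h).IsFinitePresentation where
  isFinite_presentation i :=
    { isFiniteType_generators := ⟨by
        change Finite (P.presentation i.2.1).generators.I
        infer_instance⟩
      isFiniteType_relations := ⟨by
        change Finite (P.presentation i.2.1).relations.I
        infer_instance⟩ }

omit [∀ (X : C), HasSheafify (J.over X) AddCommGrpCat.{u}] in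
/-- Shrinking the index type of a finite-presentation quasi-coherent data (Mathlib's
`QuasicoherentData.shrink`) keeps it a finite presentation. [folklore] -/
theorem quasicoherentData_shrink_isFinitePresentation
    [∀ X, HasWeakSheafify (J.over X) AddCommGrpCat.{u}] {M : SheafOfModules.{u} R}
    (q : M.QuasicoherentData) [q.IsFinitePresentation] : q.shrink.IsFinitePresentation where
  isFinite_presentation i := inferInstanceAs (q.presentation i.2.choose).IsFinite

/-- **Finite presentation is preserved by pushforward along a continuous and cocontinuous functor**
under the hypotheses of Mathlib's `isQuasicoherent_pushforward`. [folklore] -/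
theorem isFinitePresentation_pushforward
    (η : (SheafOfModules.pushforward φ).obj (SheafOfModules.unit R) ≅ SheafOfModules.unit S)
    [∀ (X : D), (Over.post G).IsContinuous (K.over X) (J.over _)]
    (h : ∀ (X : D) (Y : C) (f : G.obj X ⟶ Y),
      PreservesColimitsOfSize.{u, u} <|
      SheafOfModules.pushforward.{u} (R := (R.over Y)) (F := Over.post (X := X) G ⋙ Over.map f)
        (((Over.forget X).sheafPushforwardContinuous RingCat.{u} (K.over X) K).map φ))
    {M : SheafOfModules.{u} R} (hM : SheafOfModules.IsFinitePresentation M) :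
    SheafOfModules.IsFinitePresentation ((SheafOfModules.pushforward φ).obj M) := by
  obtain ⟨P, hP⟩ := hM.exists_quasicoherentData
  haveI := quasicoherentData_pushforward_isFinitePresentation G φ η h P
  exact ⟨⟨(P.pushforward G φ η h).shrink, quasicoherentData_shrink_isFinitePresentation _⟩⟩

set_option backward.isDefEq.respectTransparency false in
/-- **Finite presentation is preserved by pushforward along a continuous and cocontinuous left
adjoint `G` with `φ` an isomorphism** (e.g. restriction to an open, equivalences of sites).
[folklore] -/
theorem isFinitePresentation_pushforward_of_isLeftAdjoint
    (η : (SheafOfModules.pushforward φ).obj (SheafOfModules.unit R) ≅ SheafOfModules.unit S)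
    [G.IsLeftAdjoint] [IsIso φ]
    [∀ X, Functor.IsContinuous (Over.post (X := X) G) (K.over _) (J.over _)]
    [HasPullbacks C] [HasPullbacks D]
    {M : SheafOfModules.{u} R} (hM : SheafOfModules.IsFinitePresentation M) :
    SheafOfModules.IsFinitePresentation ((SheafOfModules.pushforward φ).obj M) := by
  apply +allowSynthFailures isFinitePresentation_pushforward G φ η _ hM
  intro X Y f
  let G' := Over.post (X := X) G ⋙ Over.map f
  have : G'.IsContinuous (K.over X) (J.over Y) := Functor.isContinuous_comp _ _ _ (J.over _) _
  have : G'.IsCocontinuous (K.over X) (J.over Y) := isCocontinuous_comp _ _ _ (J.over _)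
  let a : S.over X ⟶
      (G'.sheafPushforwardContinuous RingCat.{u} (K.over X) (J.over Y)).obj (R.over Y) :=
    ((Over.forget X).sheafPushforwardContinuous RingCat.{u} (K.over X) K).map φ
  have : (SheafOfModules.pushforward.{u} a).IsLeftAdjoint :=
    SheafOfModules.isLeftAdjoint_pushforward_of_isIso a
  infer_instance

variable [∀ X Y, HasSheafify ((J.over X).over Y) AddCommGrpCat.{u}]
  [∀ X Y, ((J.over X).over Y).WEqualsLocallyBijective AddCommGrpCat.{u}]

set_option backward.isDefEq.respectTransparency false in
/-- **`M.over X` is finitely presented if `M` is.** [folklore] -/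
theorem isFinitePresentation_over [HasPullbacks C] [HasBinaryProducts C] (M : SheafOfModules.{u} R)
    (X : C) (hM : SheafOfModules.IsFinitePresentation M) :
    SheafOfModules.IsFinitePresentation (M.over X) :=
  isFinitePresentation_pushforward_of_isLeftAdjoint _ _ (Iso.refl _) hM

/-- **Finite presentation glues**: if the `X i` cover the terminal object and each `M.over (X i)` has a
finite-presentation quasi-coherent data, so does `M` (Mathlib's `QuasicoherentData.bind`). [folklore] -/
theorem quasicoherentData_bind_isFinitePresentation (M : SheafOfModules.{u} R) {I : Type u}
    (X : I → C) (hX : J.CoversTop X) (D : ∀ i, SheafOfModules.QuasicoherentData (M.over (X i)))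
    [∀ i, (D i).IsFinitePresentation] :
    (SheafOfModules.QuasicoherentData.bind M X hX D).IsFinitePresentation where
  isFinite_presentation i :=
    { isFiniteType_generators := ⟨by
        change Finite ((D i.1).presentation i.2).generators.I
        infer_instance⟩
      isFiniteType_relations := ⟨by
        change Finite ((D i.1).presentation i.2).relations.I
        infer_instance⟩ }

/-- **Finite presentation is local**: if the `X i` cover the terminal object and each `M.over (X i)` is
finitely presented, then `M` is finitely presented. [folklore] -/
theorem isFinitePresentation_of_coversTop (M : SheafOfModules.{u} R) {I : Type u}
    (X : I → C) (hX : J.CoversTop X) (h : ∀ i, SheafOfModules.IsFinitePresentation (M.over (X i))) :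
    SheafOfModules.IsFinitePresentation M := by
  choose D hD using fun i ↦ (h i).exists_quasicoherentData
  haveI := quasicoherentData_bind_isFinitePresentation M X hX D
  exact ⟨⟨(SheafOfModules.QuasicoherentData.bind M X hX D).shrink,
    quasicoherentData_shrink_isFinitePresentation _⟩⟩

end Abstract

/-! ### Schemes: restriction to opens and gluing along an open cover -/

section Schemes

variable {X Y : Scheme.{u}}

set_option backward.isDefEq.respectTransparency false in
/-- **`M|_X = f^* M` is finitely presented if `M` is**, for an open immersion `f : X → Y`
(same proof as Mathlib's `Scheme.Modules.isQuasicoherent_restrictFunctor`). [cite: StacksProject, Tag 01BN] -/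
theorem isFinitePresentation_restrict (f : X ⟶ Y) [IsOpenImmersion f] (M : Y.Modules)
    (hM : SheafOfModules.IsFinitePresentation.{u, u, u} M) :
    SheafOfModules.IsFinitePresentation.{u, u, u} (M.restrict f) := by
  let α : X.presheaf ⟶ f.opensFunctor.op ⋙ Y.presheaf := { app U := (f.appIso U.unop).inv }
  have hα : IsIso α := NatIso.isIso_of_isIso_app _
  let φ : X.ringCatSheaf ⟶ (f.opensFunctor.sheafPushforwardContinuous _ _ _).obj Y.ringCatSheaf :=
    ⟨Functor.whiskerRight α (forget₂ CommRingCat RingCat)⟩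
  have : IsIso φ := by
    rw [← isIso_iff_of_reflects_iso _ (ObjectProperty.ι _)]
    dsimp [φ]
    infer_instance
  exact isFinitePresentation_pushforward_of_isLeftAdjoint.{u} f.opensFunctor φ
    (Scheme.Modules.restrictUnitIso _) hM

/-- Restricting a FINITE global presentation along an open immersion (Mathlib's
`Scheme.Modules.presentationRestrict`) gives a finite presentation. [folklore] -/
theorem presentationRestrict_isFinite (f : Y ⟶ X) [IsOpenImmersion f] {M : X.Modules}
    (pres : SheafOfModules.Presentation M) [pres.IsFinite] :
    (Scheme.Modules.presentationRestrict f pres).IsFinite :=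
  { isFiniteType_generators := ⟨by
      change Finite pres.generators.I
      infer_instance⟩
    isFiniteType_relations := ⟨by
      change Finite pres.relations.I
      infer_instance⟩ }

set_option backward.isDefEq.respectTransparency false in
/-- From a presentation of `M.over W` to a presentation of `M|_V` for an open `V ≤ W` (the construction
inside Mathlib's `Scheme.Modules.exists_isOpenCover_presentation`: transport along
`Scheme.Modules.overEquiv W` and restrict along `V ↪ W`). [folklore] -/
def presentationRestrictOfOver (M : X.Modules) {V W : X.Opens} (hVW : V ≤ W)
    (pres : SheafOfModules.Presentation (M.over W)) :
    SheafOfModules.Presentation (M.restrict V.ι) :=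
  letI u := X.homOfLE hVW
  haveI : PreservesColimitsOfSize.{u, u} (Scheme.Modules.restrictFunctor u) := inferInstance
  letI F := (Scheme.Modules.overEquiv W).functor ⋙ Scheme.Modules.restrictFunctor u
  letI iso : SheafOfModules.overFunctor X.ringCatSheaf _ ⋙ F ≅
      Scheme.Modules.restrictFunctor V.ι :=
    (Functor.associator _ _ _).symm ≪≫
      Functor.isoWhiskerRight (Scheme.Modules.overFunctorEquiv _) _ ≪≫
      (Scheme.Modules.restrictFunctorComp _ _).symm ≪≫ (Scheme.Modules.restrictFunctorCongr (by simp [u]))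
  SheafOfModules.Presentation.ofIsIso.{u, u, u} (iso.app M).hom <|
    pres.map F (Scheme.Modules.restrictUnitIso _).symm

/-- `presentationRestrictOfOver` of a finite presentation is finite. [folklore] -/
theorem presentationRestrictOfOver_isFinite (M : X.Modules) {V W : X.Opens} (hVW : V ≤ W)
    (pres : SheafOfModules.Presentation (M.over W)) [pres.IsFinite] :
    (presentationRestrictOfOver M hVW pres).IsFinite :=
  { isFiniteType_generators := ⟨by
      change Finite pres.generators.I
      infer_instance⟩
    isFiniteType_relations := ⟨by
      change Finite pres.relations.I
      infer_instance⟩ }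

/-- **A finitely presented `𝒪_X`-module has FINITE presentations `𝒪^m → 𝒪^n → M|_U → 0` on the
members `U` of some affine open cover of `X`.** [cite: StacksProject, Tag 01BN] -/
theorem exists_isOpenCover_finitePresentation (M : X.Modules)
    (hM : SheafOfModules.IsFinitePresentation.{u, u, u} M) :
    ∃ (ι : Type u) (U : ι → X.Opens) (pres : ∀ i, SheafOfModules.Presentation (M.restrict (U i).ι)),
      IsOpenCover U ∧ (∀ i, IsAffineOpen (U i)) ∧ ∀ i, (pres i).IsFinite := by
  obtain ⟨⟨I, W, cov, pres⟩, hfin⟩ := hM.exists_quasicoherentData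
  choose κ hsub heq using fun i ↦ Opens.isBasis_iff_cover.mp X.isBasis_affineOpens (W i)
  have hle : ∀ j : Σ i : I, κ i, (j.2 : X.Opens) ≤ W j.1 := fun j ↦ by
    rw [heq j.1]
    exact le_sSup j.2.2
  refine ⟨Σ (i : I), κ i, fun j ↦ j.2, fun j ↦ presentationRestrictOfOver M (hle j) (pres j.1), ?_,
    fun j ↦ hsub _ j.2.2, fun j ↦ ?_⟩
  · rw [Opens.coversTop_iff, IsOpenCover] at cov
    rw [IsOpenCover, iSup_sigma, ← cov]
    refine iSup_congr fun i ↦ ?_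
    rw [heq i, sSup_eq_iSup']
  · haveI : (pres j.1).IsFinite := hfin.isFinite_presentation j.1
    exact presentationRestrictOfOver_isFinite M (hle j) (pres j.1)

set_option backward.isDefEq.respectTransparency false in
/-- Finite presentation transports back along `Scheme.Modules.overEquiv U` (pushforward along the
equivalence of sites `Over U ≌ Opens U`). [folklore] -/
theorem isFinitePresentation_overEquiv_inverse (U : X.Opens) (N : (U : Scheme.{u}).Modules)
    (hN : SheafOfModules.IsFinitePresentation.{u, u, u} N) :
    SheafOfModules.IsFinitePresentation.{u, u, u} ((Scheme.Modules.overEquiv U).inverse.obj N) := by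
  -- `Over.post` of the equivalence `Over U ≌ Opens ↥U` is continuous since the equivalence preserves
  -- 1-hypercovers (it is cover preserving, being continuous as a dense subsite, and preserves pullbacks)
  haveI : (U.overEquivalence.symm.inverse).PreservesOneHypercovers.{u}
      ((Opens.grothendieckTopology X).over U) (Opens.grothendieckTopology ↥U) :=
    Functor.PreservesOneHypercovers.of_coverPreserving (CoverPreserving.of_isContinuous _ _ _)
  exact isFinitePresentation_pushforward_of_isLeftAdjoint.{u} _ _
    (TopologicalSpace.Opens.sheafOfModulesEquivOverInverseUnit U X.ringCatSheaf) hN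

/-- **`M.over U` is finitely presented iff `M|_U` is** (one direction; the other is
`isFinitePresentation_over` with `isFinitePresentation_restrict`). [folklore] -/
theorem isFinitePresentation_over_of_restrict (M : X.Modules) (U : X.Opens)
    (h : SheafOfModules.IsFinitePresentation.{u, u, u} (M.restrict U.ι)) :
    SheafOfModules.IsFinitePresentation.{u, u, u} (M.over U) :=
  (SheafOfModules.isFinitePresentation.{u, u, u} _).prop_of_iso
    ((Scheme.Modules.overEquiv U).inverse.mapIso ((Scheme.Modules.overFunctorEquiv U).app M).symm ≪≫
      ((Scheme.Modules.overEquiv U).unitIso.app _).symm)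
    (isFinitePresentation_overEquiv_inverse U _ h)

/-- **Finite presentation is local on `X`**: if `M|_{U_i}` is finitely presented for an open cover
`(U_i)` of `X`, then `M` is finitely presented. [cite: StacksProject, Tag 01BN] -/
theorem isFinitePresentation_of_isOpenCover (M : X.Modules) {ι : Type u} (U : ι → X.Opens)
    (hU : IsOpenCover U) (h : ∀ i, SheafOfModules.IsFinitePresentation.{u, u, u} (M.restrict (U i).ι)) :
    SheafOfModules.IsFinitePresentation.{u, u, u} M :=
  isFinitePresentation_of_coversTop M U (by rw [Opens.coversTop_iff]; exact hU)
    fun i ↦ isFinitePresentation_over_of_restrict M (U i) (h i)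

/-- The quasi-coherent data on the trivial cover attached to a FINITE global presentation is a finite
presentation. [folklore] -/
theorem quasicoherentData_isFinitePresentation_of_isFinite {M : X.Modules}
    (P : SheafOfModules.Presentation M) [P.IsFinite] :
    SheafOfModules.QuasicoherentData.IsFinitePresentation.{u, u, u, u} P.quasicoherentData where
  isFinite_presentation _ :=
    { isFiniteType_generators := ⟨by
        change Finite P.generators.I
        infer_instance⟩
      isFiniteType_relations := ⟨by
        change Finite P.relations.I
        infer_instance⟩ }

/-- A module with a FINITE global presentation is finitely presented. [folklore] -/
theorem isFinitePresentation_of_presentation {M : X.Modules} (P : SheafOfModules.Presentation M)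
    [P.IsFinite] : SheafOfModules.IsFinitePresentation.{u, u, u} M :=
  SheafOfModules.IsFinitePresentation.mk.{u, u, u}
    ⟨P.quasicoherentData, quasicoherentData_isFinitePresentation_of_isFinite P⟩

/-- **Finite presentation is local on `X`** (presentation form): finite presentations of the
`M|_{U_i}` for an open cover `(U_i)` make `M` finitely presented. [cite: StacksProject, Tag 01BN] -/
theorem isFinitePresentation_of_presentations (M : X.Modules) {ι : Type u} (U : ι → X.Opens)
    (hU : IsOpenCover U) (pres : ∀ i, SheafOfModules.Presentation (M.restrict (U i).ι))
    [∀ i, (pres i).IsFinite] : SheafOfModules.IsFinitePresentation.{u, u, u} M :=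
  isFinitePresentation_of_isOpenCover M U hU fun i ↦ isFinitePresentation_of_presentation (pres i)

/-- An isomorphism of `𝒪_X`-modules regarded as an isomorphism of sheaves of modules over
`X.ringCatSheaf` (Mathlib's `Scheme.Modules` is a type synonym with its own category instance). [folklore] -/
def isoSheafOfModules {M M' : X.Modules} (e : M ≅ M') :
    @Iso (SheafOfModules.{u} X.ringCatSheaf) _ M M' where
  hom := e.hom
  inv := e.inv
  hom_inv_id := e.hom_inv_id
  inv_hom_id := e.inv_hom_id

/-- Finite presentation is invariant under isomorphism of `𝒪_X`-modules. [folklore] -/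
theorem isFinitePresentation_of_iso {M M' : X.Modules} (e : M ≅ M')
    (h : SheafOfModules.IsFinitePresentation.{u, u, u} M) :
    SheafOfModules.IsFinitePresentation.{u, u, u} M' :=
  (SheafOfModules.isFinitePresentation.{u, u, u} X.ringCatSheaf).prop_of_iso (isoSheafOfModules e) h

/-- `M|_{f(X)}` (restriction to the open image) is finitely presented if `M|_X = f^*M` is, for an open
immersion `f : X → Y` (`X ≅ f(X)`). [folklore] -/
theorem isFinitePresentation_restrict_opensRange (f : X ⟶ Y) [IsOpenImmersion f] (M : Y.Modules)
    (h : SheafOfModules.IsFinitePresentation.{u, u, u} (M.restrict f)) :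
    SheafOfModules.IsFinitePresentation.{u, u, u} (M.restrict f.opensRange.ι) :=
  letI iso : Scheme.Modules.restrictFunctor f.opensRange.ι ≅
      Scheme.Modules.restrictFunctor f ⋙ Scheme.Modules.restrictFunctor f.isoOpensRange.inv :=
    Scheme.Modules.restrictFunctorCongr (f.isoOpensRange_inv_comp).symm ≪≫
      Scheme.Modules.restrictFunctorComp _ _
  isFinitePresentation_of_iso (iso.app M).symm (isFinitePresentation_restrict f.isoOpensRange.inv _ h)

/-- **Finite presentation is local on `X`** (open-cover form): if `M|_{U_i} = f_i^* M` is finitely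
presented for every member `f_i : U_i → X` of an open cover of `X`, then `M` is finitely presented.
[cite: StacksProject, Tag 01BN] -/
theorem isFinitePresentation_of_openCover (M : X.Modules) (𝒰 : Scheme.OpenCover.{u} X)
    (h : ∀ i, SheafOfModules.IsFinitePresentation.{u, u, u} (M.restrict (𝒰.f i))) :
    SheafOfModules.IsFinitePresentation.{u, u, u} M :=
  isFinitePresentation_of_isOpenCover M (fun i ↦ (𝒰.f i).opensRange) 𝒰.isOpenCover_opensRange
    fun i ↦ isFinitePresentation_restrict_opensRange (𝒰.f i) M (h i)

end Schemes

end Literature.AlgebraicGeometry.Modules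

end
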